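import Mathlib.Topology.Algebra.InfiniteSum.Constructions
import Mathlib.Topology.Algebra.InfiniteSum.ENNReal
import Summits.CriticalPhenomena.SAWScalingLimit.Theorems.SAWTotalPositivityBoundaryTP2Defs
import Summits.CriticalPhenomena.SAWScalingLimit.Theorems.EdgeOfPositivity.Negative.EdgeOfPositivityRectDomain
import HarnessLib

/-!
# Crux `BoundaryTP2` (stmt-CriticalPhenomena-7115), line `Sketch`: disjoint-pair recursion of the strips

Tool stub `stub_strip3_recPair` (C3). On `S_L = discreteDomainGraph (rectDomain L 2) 1` (sites
`{0..L} × {0,1,2}`) the disjoint-pair kernels `PP_L(r;s) = Σ x^{|γ|+|γ'|}` over the vertex-disjoint pairs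
`γ : (0,r) → (L,s)`, `γ' : (L,1) → (L,2-s)` (`s ∈ {0,2}`) satisfy, for all `L` and `x ≥ 0`,
`PP_{L+1}(r;s) = x² Z_{S_L}((0,r),(L,s)) + x³ PP_L(r;s)`. Proof: write `t = (L+1,s)`, `m = (L+1,1)`,
`t̄ = (L+1,2-s)`. For a disjoint pair of `S_{L+1}` the loop `γ'` leaves `m` towards `t̄` (the rung) or
towards `(L,1)`, re-entering `t̄` from `(L,2-s)` after a path `δ` of `S_L`; the step to `t ∈ γ` is
excluded. And `γ` enters `t` from `(L,s)` after a path `γ₀` of `S_L` (it avoids `m, t̄ ∈ γ'`). These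
gluings are injective with every disjoint pair in their range (`s3p_exists_glue`, stated for an abstract
pendant column `t, m, t̄` of a graph `G ≥ G₀`; walk surgery by `Walk.transfer` / `concat`), and the sum is
transported along them (`Function.Injective.tsum_eq`, `Summable.tsum_sum`: `s3p_abstract`). The strip
instance is coordinate bookkeeping on `Site 2` closed by `omega`.
-/

noncomputable section

namespace Summit.CriticalPhenomena.SAWScalingLimit.Theorems.BoundaryTP2

open SimpleGraph Walk
open Literature.Probability.LatticeModels Literature.Probability.RandomPlanarGeometry
open Summit.CriticalPhenomena.SAWScalingLimit.Theorems.EdgeOfPositivity.Negative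
open scoped ENNReal

variable {V : Type*}

/-- If every edge of `G` ends in `P`, a walk of `G` that starts in `P` stays in `P`. [folklore] -/
private theorem s3p_forall_mem_support {G : SimpleGraph V} {P : V → Prop}
    (hG : ∀ u v, G.Adj u v → P v) {u v : V} (p : G.Walk u v) (hu : P u) : ∀ z ∈ p.support, P z := by
  induction p with
  | nil => intro z hz; rw [support_nil, List.mem_singleton] at hz; exact hz ▸ hu
  | cons h q ih =>
    intro z hz
    rw [support_cons, List.mem_cons] at hz
    rcases hz with rfl | hz
    exacts [hu, ih (hG _ _ h) z hz]

/-- The edges of a walk of `H` whose vertices satisfy `P` lie in any graph `G` containing the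
`P`-internal edges of `H`. [folklore] -/
private theorem s3p_edges_mem_of_support {H G : SimpleGraph V} {P : V → Prop}
    (hG : ∀ u v, H.Adj u v → P u → P v → G.Adj u v) {u v : V} (p : H.Walk u v)
    (hp : ∀ z ∈ p.support, P z) : ∀ e, e ∈ p.edges → e ∈ G.edgeSet := by
  induction p with
  | nil => intro e he; simp at he
  | cons h q ih =>
    intro e he
    rw [edges_cons, List.mem_cons] at he
    rcases he with rfl | he
    · exact (mem_edgeSet G).2 (hG _ _ h (hp _ (by simp)) (hp _ (by simp)))
    · exact ih (fun z hz => hp z (by simp [hz])) e he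

/-- The edges of a walk of a subgraph `G ≤ H` are edges of `H`. [folklore] -/
private theorem s3p_edges_mem_of_le {G H : SimpleGraph V} (hle : G ≤ H) {u v : V} (p : G.Walk u v) :
    ∀ e, e ∈ p.edges → e ∈ H.edgeSet :=
  fun _ he => edgeSet_mono hle (p.edges_subset_edgeSet he)

/-- **Peeling the last edge.** A path `p : u → w` (`u ≠ w`) of `H` whose last step can only come from
`e` and whose vertices `≠ w` satisfy `P` is `p₀ · (e w)` for a path `p₀ : u → e` of any `G ≤ H`
containing the `P`-internal edges of `H`. [folklore] -/
private theorem s3p_peel {H G : SimpleGraph V} {P : V → Prop} (hle : G ≤ H)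
    (hG : ∀ u v, H.Adj u v → P u → P v → G.Adj u v) {u w e : V} (p : H.Walk u w) (hp : p.IsPath)
    (hne : u ≠ w) (hlast : ∀ v, H.Adj w v → v ∈ p.support → v = e)
    (hP : ∀ z ∈ p.support, z ≠ w → P z) :
    ∃ (p₀ : G.Walk u e) (h : H.Adj e w), p₀.IsPath ∧
      p = (p₀.transfer H (s3p_edges_mem_of_le hle p₀)).concat h := by
  obtain ⟨v, h, q, hq⟩ := exists_eq_cons_of_ne hne.symm p.reverse
  have hsub : ∀ z ∈ q.support, z ∈ p.support := fun z hz => by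
    rw [← List.mem_reverse, ← support_reverse, hq, support_cons]
    exact List.mem_cons_of_mem _ hz
  obtain rfl : v = e := hlast v h (hsub v q.start_mem_support)
  have hrev := hp.reverse
  rw [hq, cons_isPath_iff] at hrev
  have hPq : ∀ z ∈ q.reverse.support, P z := fun z hz => by
    rw [support_reverse, List.mem_reverse] at hz
    exact hP z (hsub z hz) fun hzw => hrev.2 (hzw ▸ hz)
  refine ⟨q.reverse.transfer G (s3p_edges_mem_of_support hG _ hPq), h.symm,
    hrev.1.reverse.transfer _, ?_⟩
  conv_lhs => rw [← reverse_reverse p, hq, reverse_cons]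
  rw [transfer_transfer, transfer_self]
  rfl

/-- The gluing `γ₀ ↦ γ₀ · (ps t)` (after transfer to the big graph) is injective. [folklore] -/
private theorem s3p_glueL_inj {G₀ G : SimpleGraph V} (hle : G₀ ≤ G) {a ps t : V} (hpt : G.Adj ps t)
    {γ γ' : G₀.Walk a ps} (h : (γ.transfer G (s3p_edges_mem_of_le hle γ)).concat hpt =
      (γ'.transfer G (s3p_edges_mem_of_le hle γ')).concat hpt) : γ = γ' := by
  have h' := congrArg edges h
  simp only [edges_concat, edges_transfer, List.concat_eq_append] at h'
  exact edges_injective (List.append_cancel_right h')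

/-- The gluing `δ ↦ (m p1) · δ · (psb tb)` (after transfer to the big graph) is injective. [folklore] -/
private theorem s3p_glueR_inj {G₀ G : SimpleGraph V} (hle : G₀ ≤ G) {p1 psb m tb : V}
    (hmp1 : G.Adj m p1) (hptb : G.Adj psb tb) {δ δ' : G₀.Walk p1 psb}
    (h : cons hmp1 ((δ.transfer G (s3p_edges_mem_of_le hle δ)).concat hptb) =
      cons hmp1 ((δ'.transfer G (s3p_edges_mem_of_le hle δ')).concat hptb)) : δ = δ' := by
  have h' := congrArg edges h
  simp only [edges_cons, edges_concat, edges_transfer, List.concat_eq_append, List.cons.injEq,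
    true_and] at h'
  exact edges_injective (List.append_cancel_right h')

/-- **The gluing map** (abstract pendant column). `G₀ ≤ G` on one vertex type; new vertices `t, m, tb`
of `G` with `N(t) ⊆ {ps, m}`, `N(m) ⊆ {p1, t, tb}`, `N(tb) ⊆ {m, psb}`; the edges of `G` between old
vertices are edges of `G₀`, whose edges end at old vertices. Then `γ₀ ↦ (γ₀ · ps t, m tb)` and
`(γ₀, δ) ↦ (γ₀ · ps t, m p1 · δ · psb tb)` form an injection
`Path_{G₀}(a,ps) ⊕ Path_{G₀}(a,ps) × Path_{G₀}(p1,psb) → Path_G(a,t) × Path_G(m,tb)` whose range contains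
every vertex-disjoint pair, preserving disjointness, with the stated lengths. [folklore] -/
private theorem s3p_exists_glue {G₀ G : SimpleGraph V} {a ps p1 psb t m tb : V} (hle : G₀ ≤ G)
    (hold : ∀ u v, G.Adj u v → (u ≠ t ∧ u ≠ m ∧ u ≠ tb) → (v ≠ t ∧ v ≠ m ∧ v ≠ tb) → G₀.Adj u v)
    (hG₀ : ∀ u v, G₀.Adj u v → v ≠ t ∧ v ≠ m ∧ v ≠ tb)
    (ha : a ≠ t ∧ a ≠ m ∧ a ≠ tb) (hp1 : p1 ≠ t ∧ p1 ≠ m ∧ p1 ≠ tb)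
    (hpt : G.Adj ps t) (hmtb : G.Adj m tb) (hmp1 : G.Adj m p1) (hptb : G.Adj psb tb)
    (hNt : ∀ u, G.Adj t u → u = ps ∨ u = m) (hNm : ∀ u, G.Adj m u → u = p1 ∨ u = t ∨ u = tb)
    (hNtb : ∀ u, G.Adj tb u → u = m ∨ u = psb) (htm : t ≠ m) (httb : t ≠ tb) (hmtb' : m ≠ tb) :
    ∃ g : G₀.Path a ps ⊕ (G₀.Path a ps × G₀.Path p1 psb) → G.Path a t × G.Path m tb,
      Function.Injective g ∧
      (∀ q : G.Path a t × G.Path m tb, List.Disjoint q.1.1.support q.2.1.support →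
        q ∈ Set.range g) ∧
      (∀ γ₀, List.Disjoint (g (Sum.inl γ₀)).1.1.support (g (Sum.inl γ₀)).2.1.support ∧
        (g (Sum.inl γ₀)).1.1.length = γ₀.1.length + 1 ∧ (g (Sum.inl γ₀)).2.1.length = 1) ∧
      (∀ q, (List.Disjoint (g (Sum.inr q)).1.1.support (g (Sum.inr q)).2.1.support ↔
          List.Disjoint q.1.1.support q.2.1.support) ∧
        (g (Sum.inr q)).1.1.length = q.1.1.length + 1 ∧
        (g (Sum.inr q)).2.1.length = q.2.1.length + 2) := by
  -- walks of `G₀` issued from `a` or `p1` avoid the new vertices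
  have hPa : ∀ {u : V} (w : G₀.Walk a u) (z : V), z ∈ w.support → z ≠ t ∧ z ≠ m ∧ z ≠ tb :=
    fun w => s3p_forall_mem_support (P := fun z => z ≠ t ∧ z ≠ m ∧ z ≠ tb) hG₀ w ha
  have hPp : ∀ {u : V} (w : G₀.Walk p1 u) (z : V), z ∈ w.support → z ≠ t ∧ z ≠ m ∧ z ≠ tb :=
    fun w => s3p_forall_mem_support (P := fun z => z ≠ t ∧ z ≠ m ∧ z ≠ tb) hG₀ w hp1
  -- the glued walks are self-avoiding
  have hL : ∀ γ₀ : G₀.Path a ps,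
      ((γ₀.1.transfer G (s3p_edges_mem_of_le hle γ₀.1)).concat hpt).IsPath := fun γ₀ =>
    (γ₀.2.transfer _).concat (by rw [support_transfer]; exact fun h => (hPa γ₀.1 t h).1 rfl) hpt
  have hE : (cons hmtb (nil : G.Walk tb tb)).IsPath := by
    rw [cons_isPath_iff, support_nil, List.mem_singleton]
    exact ⟨IsPath.nil, hmtb'⟩
  have hR : ∀ δ : G₀.Path p1 psb,
      (cons hmp1 ((δ.1.transfer G (s3p_edges_mem_of_le hle δ.1)).concat hptb)).IsPath := by
    intro δ
    rw [cons_isPath_iff, support_concat, support_transfer, List.mem_append, List.mem_singleton,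
      not_or]
    exact ⟨(δ.2.transfer _).concat (by rw [support_transfer]; exact fun h => (hPp δ.1 tb h).2.2 rfl)
      hptb, fun h => (hPp δ.1 m h).2.1 rfl, hmtb'⟩
  refine ⟨Sum.elim (fun γ₀ => (⟨_, hL γ₀⟩, ⟨_, hE⟩)) (fun q => (⟨_, hL q.1⟩, ⟨_, hR q.2⟩)),
    ?_, ?_, ?_, ?_⟩
  · -- injectivity
    rintro (γ₀ | ⟨γ₀, δ⟩) (γ₀' | ⟨γ₀', δ'⟩) h
    · exact congrArg Sum.inl (Subtype.ext (s3p_glueL_inj hle hpt (congrArg (fun q => q.1.1) h)))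
    pick_goal 3
    · exact congrArg Sum.inr (Prod.ext (Subtype.ext (s3p_glueL_inj hle hpt
        (congrArg (fun q => q.1.1) h))) (Subtype.ext (s3p_glueR_inj hle hmp1 hptb
        (congrArg (fun q => q.2.1) h))))
    all_goals
      have h1 := congrArg (fun q => q.2.1.length) h
      simp only [Sum.elim_inl, Sum.elim_inr, length_cons, length_nil, length_concat] at h1
      omega
  · -- the range contains the disjoint pairs
    rintro ⟨γ, γ'⟩ hd
    have htγ' : t ∉ γ'.1.support := fun h => hd γ.1.end_mem_support h
    have hmγ : m ∉ γ.1.support := fun h => hd h γ'.1.start_mem_support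
    have htbγ : tb ∉ γ.1.support := fun h => hd h γ'.1.end_mem_support
    -- `γ` enters `t` from `ps` after a path of `G₀`
    obtain ⟨γ₀, hpt', hγ₀, hγ⟩ := s3p_peel (P := fun z => z ≠ t ∧ z ≠ m ∧ z ≠ tb) hle hold γ.1 γ.2
      ha.1 (fun v hv hvγ => (hNt v hv).resolve_right fun hvm => hmγ (hvm ▸ hvγ))
      (fun z hz hzt => ⟨hzt, fun hzm => hmγ (hzm ▸ hz), fun hztb => htbγ (hztb ▸ hz)⟩)
    -- the first step of `γ'`: to `p1` (a dip through `G₀`), to `t` (excluded) or to `tb` (the rung)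
    obtain ⟨v, hmv, q, hq⟩ := exists_eq_cons_of_ne hmtb' γ'.1
    have hq' := γ'.2
    rw [hq, cons_isPath_iff] at hq'
    have hqsub : ∀ z ∈ q.support, z ∈ γ'.1.support := fun z hz => by
      rw [hq, support_cons]
      exact List.mem_cons_of_mem _ hz
    rcases hNm v hmv with rfl | rfl | rfl
    · obtain ⟨δ, hptb', hδ, hqδ⟩ := s3p_peel (P := fun z => z ≠ t ∧ z ≠ m ∧ z ≠ tb) hle hold q
        hq'.1 hp1.2.2 (fun u hu huq => (hNtb u hu).resolve_left fun hum => hq'.2 (hum ▸ huq))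
        (fun z hz hztb => ⟨fun hzt => htγ' (hzt ▸ hqsub z hz), fun hzm => hq'.2 (hzm ▸ hz), hztb⟩)
      refine Set.mem_range.2 ⟨Sum.inr (⟨γ₀, hγ₀⟩, ⟨δ, hδ⟩), ?_⟩
      simp only [Sum.elim_inr]
      refine Prod.ext (Subtype.ext hγ.symm) (Subtype.ext ?_)
      change _ = γ'.1
      rw [hq, hqδ]
    · exact absurd (hqsub _ q.start_mem_support) htγ'
    · have hqnil : q = nil := eq_nil_iff_nil.2 (isPath_iff_nil.1 hq'.1)
      refine Set.mem_range.2 ⟨Sum.inl ⟨γ₀, hγ₀⟩, ?_⟩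
      simp only [Sum.elim_inl]
      refine Prod.ext (Subtype.ext hγ.symm) (Subtype.ext ?_)
      change _ = γ'.1
      rw [hq, hqnil]
  · -- the rung class: always disjoint; lengths
    intro γ₀
    simp only [Sum.elim_inl, support_concat, support_transfer, support_cons, support_nil,
      length_concat, length_transfer, length_cons, length_nil]
    refine ⟨fun z hz hz' => ?_, trivial, trivial⟩
    rw [List.mem_append, List.mem_singleton] at hz
    rw [List.mem_cons, List.mem_singleton] at hz'
    rcases hz with hz | rfl
    · exact hz'.elim (hPa γ₀.1 z hz).2.1 (hPa γ₀.1 z hz).2.2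
    · exact hz'.elim htm httb
  · -- the dipping class: disjoint iff the pieces are; lengths
    rintro ⟨γ₀, δ⟩
    simp only [Sum.elim_inr, support_concat, support_transfer, support_cons, length_concat,
      length_transfer, length_cons]
    refine ⟨⟨fun h z hz hz' => h (List.mem_append_left _ hz)
      (List.mem_cons_of_mem _ (List.mem_append_left _ hz')), fun h z hz hz' => ?_⟩, trivial, trivial⟩
    rw [List.mem_append, List.mem_singleton] at hz
    rw [List.mem_cons, List.mem_append, List.mem_singleton] at hz'
    rcases hz with hz | rfl
    · rcases hz' with rfl | hz' | rfl
      exacts [(hPa γ₀.1 _ hz).2.1 rfl, h hz hz', (hPa γ₀.1 _ hz).2.2 rfl]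
    · rcases hz' with h' | hz' | h'
      exacts [htm h', (hPp δ.1 _ hz').1 rfl, httb h']

open Classical in
/-- **The disjoint-pair recursion, abstract form.** In the setting of `s3p_exists_glue`, for `x ≥ 0`,
`Σ_{(γ,γ') disjoint} x^{|γ|+|γ'|} = x² Z_{G₀}(a,ps) + x³ Σ_{(γ₀,δ) disjoint} x^{|γ₀|+|δ|}`: reparametrise
the disjoint pairs by the gluing map (`Function.Injective.tsum_eq`) and split the sum over the two
classes (`Summable.tsum_sum`). [folklore] -/
private theorem s3p_abstract {G₀ G : SimpleGraph V} {a ps p1 psb t m tb : V} (x : ℝ) (hx : 0 ≤ x)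
    (hle : G₀ ≤ G)
    (hold : ∀ u v, G.Adj u v → (u ≠ t ∧ u ≠ m ∧ u ≠ tb) → (v ≠ t ∧ v ≠ m ∧ v ≠ tb) → G₀.Adj u v)
    (hG₀ : ∀ u v, G₀.Adj u v → v ≠ t ∧ v ≠ m ∧ v ≠ tb)
    (ha : a ≠ t ∧ a ≠ m ∧ a ≠ tb) (hp1 : p1 ≠ t ∧ p1 ≠ m ∧ p1 ≠ tb)
    (hpt : G.Adj ps t) (hmtb : G.Adj m tb) (hmp1 : G.Adj m p1) (hptb : G.Adj psb tb)
    (hNt : ∀ u, G.Adj t u → u = ps ∨ u = m) (hNm : ∀ u, G.Adj m u → u = p1 ∨ u = t ∨ u = tb)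
    (hNtb : ∀ u, G.Adj tb u → u = m ∨ u = psb) (htm : t ≠ m) (httb : t ≠ tb) (hmtb' : m ≠ tb) :
    (∑' (γ : G.Path a t) (γ' : G.Path m tb),
      (if List.Disjoint γ.1.support γ'.1.support then
        ENNReal.ofReal (x ^ γ.1.length) * ENNReal.ofReal (x ^ γ'.1.length) else 0)) =
      ENNReal.ofReal (x ^ 2) * pathKernel G₀ x a ps +
        ENNReal.ofReal (x ^ 3) *
          (∑' (γ : G₀.Path a ps) (γ' : G₀.Path p1 psb),
            (if List.Disjoint γ.1.support γ'.1.support then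
              ENNReal.ofReal (x ^ γ.1.length) * ENNReal.ofReal (x ^ γ'.1.length) else 0)) := by
  obtain ⟨g, hinj, hrange, hinl, hinr⟩ :=
    s3p_exists_glue hle hold hG₀ ha hp1 hpt hmtb hmp1 hptb hNt hNm hNtb htm httb hmtb'
  -- the double sum as a sum over pairs, reparametrised by `g`
  have h1 : (∑' (γ : G.Path a t) (γ' : G.Path m tb),
      (if List.Disjoint γ.1.support γ'.1.support then
        ENNReal.ofReal (x ^ γ.1.length) * ENNReal.ofReal (x ^ γ'.1.length) else 0)) =
      ∑' s, (if List.Disjoint (g s).1.1.support (g s).2.1.support then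
        ENNReal.ofReal (x ^ (g s).1.1.length) * ENNReal.ofReal (x ^ (g s).2.1.length) else 0) :=
    calc _ = ∑' q : G.Path a t × G.Path m tb, (if List.Disjoint q.1.1.support q.2.1.support then
          ENNReal.ofReal (x ^ q.1.1.length) * ENNReal.ofReal (x ^ q.2.1.length) else 0) :=
        (ENNReal.tsum_prod (f := fun (γ : G.Path a t) (γ' : G.Path m tb) =>
          if List.Disjoint γ.1.support γ'.1.support then
            ENNReal.ofReal (x ^ γ.1.length) * ENNReal.ofReal (x ^ γ'.1.length) else 0)).symm
      _ = _ := by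
        refine (hinj.tsum_eq (f := fun q : G.Path a t × G.Path m tb =>
          if List.Disjoint q.1.1.support q.2.1.support then
            ENNReal.ofReal (x ^ q.1.1.length) * ENNReal.ofReal (x ^ q.2.1.length) else 0) ?_).symm
        intro q hq
        rw [Function.mem_support] at hq
        refine hrange q ?_
        by_contra hd
        exact hq (if_neg hd)
  -- the weights on the two classes
  have h2 : ∀ γ₀ : G₀.Path a ps,
      (if List.Disjoint (g (Sum.inl γ₀)).1.1.support (g (Sum.inl γ₀)).2.1.support then
        ENNReal.ofReal (x ^ (g (Sum.inl γ₀)).1.1.length) *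
          ENNReal.ofReal (x ^ (g (Sum.inl γ₀)).2.1.length) else 0) =
      ENNReal.ofReal (x ^ 2) * ENNReal.ofReal (x ^ γ₀.1.length) := by
    intro γ₀
    obtain ⟨hd, hl1, hl2⟩ := hinl γ₀
    rw [if_pos hd, hl1, hl2, ← ENNReal.ofReal_mul (pow_nonneg hx _),
      ← ENNReal.ofReal_mul (pow_nonneg hx _)]
    congr 1
    ring
  have h3 : ∀ q : G₀.Path a ps × G₀.Path p1 psb,
      (if List.Disjoint (g (Sum.inr q)).1.1.support (g (Sum.inr q)).2.1.support then
        ENNReal.ofReal (x ^ (g (Sum.inr q)).1.1.length) *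
          ENNReal.ofReal (x ^ (g (Sum.inr q)).2.1.length) else 0) =
      ENNReal.ofReal (x ^ 3) * (if List.Disjoint q.1.1.support q.2.1.support then
        ENNReal.ofReal (x ^ q.1.1.length) * ENNReal.ofReal (x ^ q.2.1.length) else 0) := by
    intro q
    obtain ⟨hd, hl1, hl2⟩ := hinr q
    by_cases h : List.Disjoint q.1.1.support q.2.1.support
    · rw [if_pos (hd.2 h), if_pos h, hl1, hl2, ← ENNReal.ofReal_mul (pow_nonneg hx _),
        ← ENNReal.ofReal_mul (pow_nonneg hx _), ← ENNReal.ofReal_mul (pow_nonneg hx _)]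
      congr 1
      ring
    · rw [if_neg (fun h' => h (hd.1 h')), if_neg h, mul_zero]
  rw [h1, Summable.tsum_sum ENNReal.summable ENNReal.summable, tsum_congr h2, tsum_congr h3,
    ENNReal.tsum_mul_left, ENNReal.tsum_mul_left,
    ENNReal.tsum_prod (f := fun (γ : G₀.Path a ps) (γ' : G₀.Path p1 psb) =>
      if List.Disjoint γ.1.support γ'.1.support then
        ENNReal.ofReal (x ^ γ.1.length) * ENNReal.ofReal (x ^ γ'.1.length) else 0)]
  rfl

/-- Adjacency in `ℤ²` in coordinates. [folklore] -/
private theorem s3p_zd_adj_iff (u v : Site 2) :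
    (zdGraph 2).Adj u v ↔ ((v 0 = u 0 + 1 ∨ u 0 = v 0 + 1) ∧ v 1 = u 1) ∨
      ((v 1 = u 1 + 1 ∨ u 1 = v 1 + 1) ∧ v 0 = u 0) := by
  rw [zdGraph_adj_iff, Fin.exists_fin_two]
  simp only [funext_iff, Fin.forall_fin_two, Pi.add_apply, Pi.single_eq_same,
    Pi.single_eq_of_ne (one_ne_zero : (1 : Fin 2) ≠ 0),
    Pi.single_eq_of_ne (zero_ne_one : (0 : Fin 2) ≠ 1), add_zero]
  omega

/-- A site equals `st a b` iff its two coordinates are `a` and `b`. [folklore] -/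
private theorem s3p_eq_st_iff (v : Site 2) (a b : ℤ) : v = st a b ↔ v 0 = a ∧ v 1 = b :=
  ⟨fun h => h ▸ ⟨rfl, rfl⟩, fun h => by rw [← st_eta v, h.1, h.2]⟩

/-- Adjacency of the strip `{0..n} × {0,1,2}` in coordinates. [folklore] -/
private theorem s3p_adj_iff (n : ℕ) (u v : Site 2) :
    (discreteDomainGraph (rectDomain n 2) 1).Adj u v ↔
      (((v 0 = u 0 + 1 ∨ u 0 = v 0 + 1) ∧ v 1 = u 1) ∨ ((v 1 = u 1 + 1 ∨ u 1 = v 1 + 1) ∧ v 0 = u 0)) ∧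
        ((0 ≤ u 0 ∧ u 0 ≤ n) ∧ (0 ≤ u 1 ∧ u 1 ≤ 2)) ∧ ((0 ≤ v 0 ∧ v 0 ≤ n) ∧ (0 ≤ v 1 ∧ v 1 ≤ 2)) := by
  rw [adj_rect_iff, s3p_zd_adj_iff, mem_rectSites_iff, mem_rectSites_iff, Nat.cast_ofNat]

/-- The sites of `S_L` are the sites of `S_{L+1}` off the new column `L+1`. [folklore] -/
private theorem s3p_mem_old_iff (L : ℕ) (s : ℤ) (hs : s = 0 ∨ s = 2) (u : Site 2) :
    u ∈ rectSites L 2 ↔ u ∈ rectSites (L + 1) 2 ∧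
      (u ≠ st (L + 1 : ℕ) s ∧ u ≠ st (L + 1 : ℕ) 1 ∧ u ≠ st (L + 1 : ℕ) (2 - s)) := by
  rw [mem_rectSites_iff, mem_rectSites_iff, Ne, Ne, Ne, s3p_eq_st_iff, s3p_eq_st_iff, s3p_eq_st_iff]
  omega

/-- The edges `(L,s)(L+1,s)`, `(L+1,1)(L+1,2-s)`, `(L+1,1)(L,1)`, `(L,2-s)(L+1,2-s)` of `S_{L+1}`, and the
three sites of its last column are distinct. [folklore] -/
private theorem s3p_column (L : ℕ) (s : ℤ) (hs : s = 0 ∨ s = 2) :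
    ((discreteDomainGraph (rectDomain (L + 1) 2) 1).Adj (st L s) (st (L + 1 : ℕ) s) ∧
      (discreteDomainGraph (rectDomain (L + 1) 2) 1).Adj (st (L + 1 : ℕ) 1) (st (L + 1 : ℕ) (2 - s)) ∧
      (discreteDomainGraph (rectDomain (L + 1) 2) 1).Adj (st (L + 1 : ℕ) 1) (st L 1) ∧
      (discreteDomainGraph (rectDomain (L + 1) 2) 1).Adj (st L (2 - s)) (st (L + 1 : ℕ) (2 - s))) ∧
    (st (L + 1 : ℕ) s ≠ st (L + 1 : ℕ) 1 ∧ st (L + 1 : ℕ) s ≠ st (L + 1 : ℕ) (2 - s) ∧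
      st (L + 1 : ℕ) 1 ≠ st (L + 1 : ℕ) (2 - s)) := by
  refine ⟨⟨?_, ?_, ?_, ?_⟩, ?_⟩
  · rw [s3p_adj_iff]; dsimp only [st_zero, st_one]; omega
  · rw [s3p_adj_iff]; dsimp only [st_zero, st_one]; omega
  · rw [s3p_adj_iff]; dsimp only [st_zero, st_one]; omega
  · rw [s3p_adj_iff]; dsimp only [st_zero, st_one]; omega
  · rw [Ne, Ne, Ne, s3p_eq_st_iff, s3p_eq_st_iff, s3p_eq_st_iff]; dsimp only [st_zero, st_one]; omega

/-- The neighbours, in `S_{L+1}`, of the three sites of its last column. [folklore] -/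
private theorem s3p_nbrs (L : ℕ) (s : ℤ) (hs : s = 0 ∨ s = 2) :
    (∀ u, (discreteDomainGraph (rectDomain (L + 1) 2) 1).Adj (st (L + 1 : ℕ) s) u →
        u = st L s ∨ u = st (L + 1 : ℕ) 1) ∧
      (∀ u, (discreteDomainGraph (rectDomain (L + 1) 2) 1).Adj (st (L + 1 : ℕ) 1) u →
        u = st L 1 ∨ u = st (L + 1 : ℕ) s ∨ u = st (L + 1 : ℕ) (2 - s)) ∧
      (∀ u, (discreteDomainGraph (rectDomain (L + 1) 2) 1).Adj (st (L + 1 : ℕ) (2 - s)) u →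
        u = st (L + 1 : ℕ) 1 ∨ u = st L (2 - s)) := by
  refine ⟨fun u h => ?_, fun u h => ?_, fun u h => ?_⟩
  · rw [s3p_adj_iff] at h; rw [s3p_eq_st_iff, s3p_eq_st_iff]; dsimp only [st_zero, st_one] at h; omega
  · rw [s3p_adj_iff] at h; rw [s3p_eq_st_iff, s3p_eq_st_iff, s3p_eq_st_iff]
    dsimp only [st_zero, st_one] at h; omega
  · rw [s3p_adj_iff] at h; rw [s3p_eq_st_iff, s3p_eq_st_iff]; dsimp only [st_zero, st_one] at h; omega

open Classical in
/-- STUB C3 (`stub_strip3_recPair`). Last-column recursion for the DISJOINT-PAIR kernels: the loop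
`γ' : (L+1,1) → (L+1,2-s)` is the rung (then `γ` enters `(L+1,s)` from `(L,s)` after an arbitrary path of
`S_L`) or dips `(L+1,1) → (L,1) ⋯ (L,2-s) → (L+1,2-s)` through `S_L` (then `γ` minus its last edge and the
inner part of `γ'` are a disjoint pair of `S_L` of the same type). [folklore] -/
theorem stub_strip3_recPair (L : ℕ) {x : ℝ} (hx : 0 ≤ x) (r : ℤ) (hr : 0 ≤ r ∧ r ≤ 2) (s : ℤ)
    (hs : s = 0 ∨ s = 2) :
    (∑' (γ : (discreteDomainGraph (rectDomain (L + 1) 2) 1).Path (st 0 r) (st (L + 1 : ℕ) s))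
        (γ' : (discreteDomainGraph (rectDomain (L + 1) 2) 1).Path (st (L + 1 : ℕ) 1) (st (L + 1 : ℕ) (2 - s))),
      (if List.Disjoint γ.1.support γ'.1.support then
        ENNReal.ofReal (x ^ γ.1.length) * ENNReal.ofReal (x ^ γ'.1.length) else 0)) =
      ENNReal.ofReal (x ^ 2) * pathKernel (discreteDomainGraph (rectDomain L 2) 1) x (st 0 r) (st L s) +
        ENNReal.ofReal (x ^ 3) *
          (∑' (γ : (discreteDomainGraph (rectDomain L 2) 1).Path (st 0 r) (st L s))
              (γ' : (discreteDomainGraph (rectDomain L 2) 1).Path (st L 1) (st L (2 - s))),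
            (if List.Disjoint γ.1.support γ'.1.support then
              ENNReal.ofReal (x ^ γ.1.length) * ENNReal.ofReal (x ^ γ'.1.length) else 0)) := by
  obtain ⟨⟨hpt, hmtb, hmp1, hptb⟩, htm, httb, hmtb'⟩ := s3p_column L s hs
  obtain ⟨hNt, hNm, hNtb⟩ := s3p_nbrs L s hs
  have ha : st 0 r ∈ rectSites L 2 := by rw [mem_rectSites_iff, st_zero, st_one]; omega
  have hp1 : st (L : ℤ) 1 ∈ rectSites L 2 := by rw [mem_rectSites_iff, st_zero, st_one]; omega
  exact s3p_abstract x hx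
    (fun u v h => by
      rw [adj_rect_iff] at h ⊢
      exact ⟨h.1, ((s3p_mem_old_iff L s hs u).1 h.2.1).1, ((s3p_mem_old_iff L s hs v).1 h.2.2).1⟩)
    (fun u v h hu hv => by
      rw [adj_rect_iff] at h ⊢
      exact ⟨h.1, (s3p_mem_old_iff L s hs u).2 ⟨h.2.1, hu⟩, (s3p_mem_old_iff L s hs v).2 ⟨h.2.2, hv⟩⟩)
    (fun u v h => ((s3p_mem_old_iff L s hs v).1 (adj_rect_iff.1 h).2.2).2)
    ((s3p_mem_old_iff L s hs _).1 ha).2 ((s3p_mem_old_iff L s hs _).1 hp1).2 hpt hmtb hmp1 hptb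
    hNt hNm hNtb htm httb hmtb'

end Summit.CriticalPhenomena.SAWScalingLimit.Theorems.BoundaryTP2
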